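import Literature.AlgebraicGeometry.Resolution.QuadraticTransforms
import Mathlib.Algebra.BigOperators.Group.Finset.Basic
import HarnessLib

/-!
# Crux `Steer` (stmt-ResolutionOfSingularities-16345), line `switching_dichotomy`: AFFINE TORSOR RUNS ARE APPROXIMATION
# SCHEMES — the digit expansion of a run and its value estimate

OURS (campaign `res-hironaka`, rung L ★L-G4, slot W4.1, chain W4.1; seat `res-L0-w41-stub-4` g3; Theses-free helper for the
holder res-L0-w41-lead-1's line `switching_dichotomy` and res-L0-w41-strat-1's S3 attack (B) «the digit (pseudo-Cauchy)
expansion `t = Σ c_j μ_0 ⋯ μ_j + μ_0 ⋯ μ_j s_{j+1}`»; replaces the role of no printed item; NOT a statement of the manuscript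
under review [claim: Hironaka2017, status: under-review]; AI-produced, which is weaker than expert review). Companion of
E-4/E-7 (`…EventualStep.lean`, `…DivergentTail.lean`): those say WHEN an eternal affine run exists; this file says WHAT an
affine run is, arithmetically.

**E-9 `run_digit_expansion`.** An affine torsor run `u` along subrings `R' 0 ⊆ R' 1 ⊆ ⋯ ⊆ O` (`u 0 = s`, steps
`u j = x_j · u (j+1) + g_j` with `x_j, g_j ∈ R' j`, the skeleton's `IsStrictStep` shape) carries DIGITS: for every `j`
there is `G_j` in the member `R' j` (indeed built from `g_0, …, g_{j-1}` and `x_0, …, x_{j-2}`) with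
`s − G_j = (x_0 ⋯ x_{j-1}) · u j`. **`valuation_sub_digit_le`.** Consequently, if the `u j ^ p` stay in members of `O`
(`IsTorsorRun`), `v (s − G_j) ≤ ∏_{i<j} v (x_i)`: along an ETERNAL run the digits approximate `s` to within the partial
products of the exceptional values — so where these DIVERGE (`Σ v(𝔪_i) = ∞`, the home of Φ3ᴸˢ/Φ4ᴸˢ/S3 by E-8) an eternal
affine run from `s` makes `s` a LIMIT of elements of the members (infinite distance to `Frac A₀`), and conversely bounded
distance forbids eternal affine runs there. [folklore]
-/

-- `Summit.<S>.<S>.…` duplicates the summit name by design (single-problem summit).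
set_option linter.dupNamespace false

open Literature.AlgebraicGeometry.Resolution

namespace Summit.ResolutionOfSingularities.ResolutionOfSingularities.Theorems.SwitchingDichotomy

namespace EventualMonomial

variable {K : Type} [Field K]

/-- **E-9 · digit expansion of an affine run.** If `u 0 = s` and `u j = x j * u (j + 1) + g j` with `x j, g j ∈ R' j`
along a monotone sequence of subrings, then for every `j` there is a digit sum `G ∈ R' j`
(`G_j = g_0 + x_0 g_1 + ⋯ + x_0 ⋯ x_{j-2} g_{j-1}`) with `s - G = (∏_{i<j} x i) * u j`. OURS. [folklore] -/
theorem run_digit_expansion (R' : ℕ → Subring K) (hmono : Monotone R') (s : K) (u x g : ℕ → K)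
    (hu0 : u 0 = s) (hx : ∀ j, x j ∈ R' j) (hg : ∀ j, g j ∈ R' j)
    (hstep : ∀ j, u j = x j * u (j + 1) + g j) (j : ℕ) :
    ∃ G : K, G ∈ R' j ∧ s - G = (∏ i ∈ Finset.range j, x i) * u j := by
  classical
  induction j with
  | zero => exact ⟨0, Subring.zero_mem _, by simp [hu0]⟩
  | succ j ih =>
    obtain ⟨G, hGj, hG⟩ := ih
    have hπ : (∏ i ∈ Finset.range j, x i) ∈ R' j :=
      Subring.prod_mem _ fun i hi => hmono (Finset.mem_range.mp hi).le (hx i)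
    refine ⟨G + (∏ i ∈ Finset.range j, x i) * g j,
      hmono (Nat.le_succ j) (Subring.add_mem _ hGj (Subring.mul_mem _ hπ (hg j))), ?_⟩
    rw [Finset.prod_range_succ]
    linear_combination hG + (∏ i ∈ Finset.range j, x i) * hstep j

/-- **E-9′ · value estimate of the digits.** Along an affine torsor run inside `O` (`u j ∈ O`, e.g. because
`u j ^ p` lies in a member `R' j ⊆ O`), the digit sums approximate `s`: `v (s − G_j) ≤ ∏_{i<j} v (x i)`. Where the
exceptional values diverge, an eternal affine run therefore exhibits `s` as a limit of elements of the members. OURS.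
[folklore] -/
theorem valuation_sub_digit_le (O : ValuationSubring K) (R' : ℕ → Subring K) (hmono : Monotone R')
    (s : K) (u x g : ℕ → K)
    (hu0 : u 0 = s) (hx : ∀ j, x j ∈ R' j) (hg : ∀ j, g j ∈ R' j)
    (hstep : ∀ j, u j = x j * u (j + 1) + g j) (huO : ∀ j, u j ∈ O) (j : ℕ) :
    ∃ G : K, G ∈ R' j ∧ O.valuation (s - G) ≤ ∏ i ∈ Finset.range j, O.valuation (x i) := by
  classical
  obtain ⟨G, hGj, hG⟩ := run_digit_expansion R' hmono s u x g hu0 hx hg hstep j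
  refine ⟨G, hGj, ?_⟩
  rw [hG, map_mul, map_prod]
  exact mul_le_of_le_one_right zero_le ((O.valuation_le_one_iff _).mpr (huO j))

/-- **Members of `O` raised to a power stay criteria**: if `u ^ p ∈ O` with `p ≠ 0` then `u ∈ O` (valuation rings are
integrally closed; here by values: `v u ^ p ≤ 1 ⇒ v u ≤ 1`). [folklore] -/
theorem mem_of_pow_mem (O : ValuationSubring K) {p : ℕ} (hp : p ≠ 0) {u : K} (h : u ^ p ∈ O) : u ∈ O := by
  rw [← O.valuation_le_one_iff] at h ⊢
  rw [map_pow] at h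
  by_contra hcon
  exact not_lt.mpr h (one_lt_pow₀ (not_le.mp hcon) hp)

/-- **E-9″ · the run form used by the skeleton.** For an `IsTorsorRun`-shaped run (`u 0 = s`, `u j ^ p ∈ R' j`, steps with
exceptional parameters and cleaners in `R' j`, existentially) along members of `O`: for every `j` a digit sum `G ∈ R' j`
with `v (s − G) ≤ ∏_{i<j} v (x i)` for the run's OWN exceptional parameters `x` (returned), each of value `< 1`. OURS.
[folklore] -/
theorem exists_digits_of_run (O : ValuationSubring K) (R' : ℕ → Subring K) (hmono : Monotone R')
    (hRO : ∀ j, R' j ≤ O.toSubring) {p : ℕ} (hp : p ≠ 0) (s : K) (u : ℕ → K) (hu0 : u 0 = s)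
    (hup : ∀ j, u j ^ p ∈ R' j)
    (hus : ∀ j, ∃ x' g' : K, (x' ∈ R' j ∧ x' ≠ 0 ∧ O.valuation x' < 1 ∧
        ∀ y ∈ R' j, O.valuation y < 1 → O.valuation y ≤ O.valuation x') ∧
      g' ∈ R' j ∧ u j = x' * u (j + 1) + g') :
    ∃ x : ℕ → K, (∀ j, x j ∈ R' j ∧ x j ≠ 0 ∧ O.valuation (x j) < 1) ∧
      ∀ j, ∃ G : K, G ∈ R' j ∧ O.valuation (s - G) ≤ ∏ i ∈ Finset.range j, O.valuation (x i) := by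
  classical
  choose x g hxg using hus
  refine ⟨x, fun j => ⟨(hxg j).1.1, (hxg j).1.2.1, (hxg j).1.2.2.1⟩, fun j => ?_⟩
  exact valuation_sub_digit_le O R' hmono s u x g hu0 (fun j => (hxg j).1.1) (fun j => (hxg j).2.1)
    (fun j => (hxg j).2.2) (fun j => mem_of_pow_mem O hp (hRO j (hup j))) j

end EventualMonomial

end Summit.ResolutionOfSingularities.ResolutionOfSingularities.Theorems.SwitchingDichotomy
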